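import Literature.NumberTheory.GaloisRepresentations.ResidualRepresentation
import Mathlib.RingTheory.Flat.TorsionFree
import Mathlib.RingTheory.LocalRing.Module
import HarnessLib

/-!
# Compact groups of matrices stabilise a lattice: arbitrary valuation rings

`Literature/NumberTheory/GaloisRepresentations/StableLattice.lean` proves that a continuous
homomorphism `ρ : G → GL_n(F)` from a compact group into `GL_n` of a topological field `F` is
conjugate into `GL_n(O)` for an open valuation subring `O ⊆ F` **which is a principal ideal
domain** (Serre, *Abelian ℓ-adic representations and elliptic curves* (1968), Ch. I §1.1,
Remark 1), and `ResidualRepresentation.lean` deduces integral models `ρ₀ : G → GL_n(O)`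
(`exists_integralModel`).  The valuation ring `ℤ̄_ℓ` of `ℚ̄_ℓ` — the coefficient ring of the
residual representation of a `ρ : Γ_K → GL_n(ℚ̄_ℓ)` (Allen et al., *Potential automorphy over CM
fields*, §1: "`ρ̄` … the semi-simplification of its reduction") — is not Noetherian, so this
file removes the hypothesis: the same statements hold for **every** open valuation subring.

The argument is Serre's (loc. cit.), verbatim as formalised in `StableLattice.lean`, except for
the one step that used principality: the `G`-stable `O`-module `L ⊆ Fⁿ` spanned by the columns
of the `ρ(g)` is finitely generated (finitely many cosets of the open subgroup `ρ⁻¹(GL_n(O))`)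
and torsion-free; over a valuation ring a finitely generated torsion-free module is free —
valuation rings are Bézout, torsion-free modules over Bézout domains are flat (Mathlib
`Module.Flat.flat_iff_torsion_eq_bot_of_isBezout`), and finitely generated flat modules over
local rings are free (Mathlib `Module.free_of_flat_of_isLocalRing`).  (Bourbaki, *Algèbre
commutative* VI §3 n° 6, Lemme 1: a finitely generated torsion-free module over a valuation ring
is free.)  Everything is PROVED; no definitions.

* `Literature.NumberTheory.GaloisRepresentations.exists_conj_mem_range_generalLinearGroup_map_of_valuationSubring`
  — `∃ P, ∀ g, P⁻¹ ρ(g) P ∈ GL_n(O)`, for any open valuation subring `O`.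
* `Literature.NumberTheory.GaloisRepresentations.exists_integralModel_of_valuationSubring` —
  `∃ P ρ₀, ∀ g, ρ₀(g) = P⁻¹ ρ(g) P` with `ρ₀ : G →* GL_n(O)`.

## References

* J.-P. Serre, *Abelian ℓ-adic representations and elliptic curves*, Benjamin (1968), Ch. I,
  §1.1, Remark 1. [SerreAbelianLadic1968]
* N. Bourbaki, *Algèbre commutative*, Ch. VI § 3 n° 6, Lemme 1; § 4 n° 1.
-/

noncomputable section

open scoped MatrixGroups

open Matrix Module

namespace Literature.NumberTheory.GaloisRepresentations

universe u

variable {F : Type u} [Field F] {O : ValuationSubring F} {n : ℕ}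

/-! ### Finitely generated torsion-free modules over valuation rings are free -/

/-- A finitely generated `O`-submodule of an `F`-vector space, `O ⊆ F` a valuation subring, is a
**free** `O`-module: it is torsion-free, hence flat (`O` is Bézout, Mathlib
`Module.Flat.flat_iff_torsion_eq_bot_of_isBezout`), hence free (`O` is local, Mathlib
`Module.free_of_flat_of_isLocalRing`).  Bourbaki, *Algèbre commutative* VI § 3 n° 6, Lemme 1.
[folklore] -/
theorem free_of_fg_submodule_valuationSubring {V : Type*} [AddCommGroup V] [Module F V]
    (L : Submodule O V) (hL : L.FG) : Module.Free O L := by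
  haveI : Module.Finite O L := Module.Finite.iff_fg.mpr hL
  haveI : NoZeroSMulDivisors O V := by
    refine ⟨fun {c x} h ↦ ?_⟩
    by_cases hc : c = 0
    · exact Or.inl hc
    · right
      have h' : (c : F) • x = 0 := h
      exact (smul_eq_zero.mp h').resolve_left (by exact_mod_cast hc)
  have htors : Submodule.torsion O L = ⊥ :=
    Submodule.isTorsionFree_iff_torsion_eq_bot.mp inferInstance
  haveI : Module.Flat O L := (Module.Flat.flat_iff_torsion_eq_bot_of_isBezout).mpr htors
  exact Module.free_of_flat_of_isLocalRing

/-! ### Stable lattices -/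

section Lattice

variable [TopologicalSpace F]
variable {G : Type*} [Group G] [TopologicalSpace G] [IsTopologicalGroup G] [CompactSpace G]

omit [TopologicalSpace F] in
/-- The column `j` of `M * N` is `M` applied to the column `j` of `N`. [folklore] -/
private lemma col_mul' (M N : Matrix (Fin n) (Fin n) F) (j : Fin n) :
    (fun i ↦ (M * N) i j) = M *ᵥ fun i ↦ N i j := by
  ext i
  simp [Matrix.mul_apply, Matrix.mulVec, dotProduct]

/-- **Compact groups stabilise a lattice, for any open valuation subring** (Serre, *Abelian
ℓ-adic representations*, I.1.1, Remark 1: "if `G` is compact there is a lattice of `V` stable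
under `G`").  Let `O` be an open valuation subring of the topological field `F` (no Noetherian
hypothesis: e.g. `ℤ̄_ℓ ⊆ ℚ̄_ℓ`), `G` a compact topological group and `ρ : G →ₜ* GL_n(F)`
continuous.  Then there is `P ∈ GL_n(F)` such that `P⁻¹ ρ(g) P ∈ GL_n(O)` for every `g ∈ G`.
Same proof as the accepted principal-ideal-domain version
`exists_conj_mem_range_generalLinearGroup_map` (`StableLattice.lean`), with freeness of the
finitely generated torsion-free lattice from `free_of_fg_submodule_valuationSubring`.
[cite: SerreAbelianLadic1968, Ch. I §1.1, Remark 1] -/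
theorem exists_conj_mem_range_generalLinearGroup_map_of_valuationSubring
    (hO : IsOpen (O : Set F)) (ρ : G →ₜ* GL (Fin n) F) :
    ∃ P : GL (Fin n) F, ∀ g : G,
      P⁻¹ * ρ g * P ∈ (Matrix.GeneralLinearGroup.map O.subtype).range := by
  classical
  -- the open subgroup `H = ρ⁻¹(GL_n(O))`, of finite index
  set H : Subgroup G := (Matrix.GeneralLinearGroup.map O.subtype).range.comap ρ.toMonoidHom
    with hHdef
  have hHopen : IsOpen (H : Set G) :=
    (isOpen_range_generalLinearGroup_map hO).preimage ρ.continuous_toFun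
  haveI hfin : Finite (G ⧸ H) := Subgroup.quotient_finite_of_isOpen H hHopen
  -- the lattice `L` spanned by the columns of the `ρ g`
  let col : G × Fin n → (Fin n → F) := fun p i ↦ (ρ p.1 : Matrix (Fin n) (Fin n) F) i p.2
  set L : Submodule O (Fin n → F) := Submodule.span O (Set.range col) with hLdef
  -- `L` is `G`-stable
  have hstab : ∀ (g : G) (x : Fin n → F), x ∈ L →
      (ρ g : Matrix (Fin n) (Fin n) F) *ᵥ x ∈ L := by
    intro g x hx
    have key : L ≤ L.comap (((ρ g : Matrix (Fin n) (Fin n) F).mulVecLin).restrictScalars O) := by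
      rw [hLdef, Submodule.span_le]
      rintro _ ⟨⟨g', j⟩, rfl⟩
      rw [SetLike.mem_coe, Submodule.mem_comap]
      change (ρ g : Matrix (Fin n) (Fin n) F) *ᵥ col ⟨g', j⟩ ∈ L
      refine Submodule.subset_span ⟨⟨g * g', j⟩, ?_⟩
      simp only [col, map_mul, Units.val_mul]
      exact col_mul' _ _ j
    exact key hx
  -- `L` contains the standard basis
  have hstd : ∀ j : Fin n, (Pi.single j 1 : Fin n → F) ∈ L := by
    intro j
    refine Submodule.subset_span ⟨⟨1, j⟩, ?_⟩
    ext i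
    simp [col, Matrix.one_apply, Pi.single_apply, eq_comm]
  -- `L` is finitely generated: by the columns of the `ρ gᵢ`, `gᵢ` coset representatives
  have hfg : L.FG := by
    let col₀ : (G ⧸ H) × Fin n → (Fin n → F) := fun p ↦ col ⟨p.1.out, p.2⟩
    refine ⟨(Set.finite_range col₀).toFinset, le_antisymm ?_ ?_⟩
    · rw [Set.Finite.coe_toFinset, Submodule.span_le]
      rintro _ ⟨p, rfl⟩
      exact Submodule.subset_span ⟨⟨p.1.out, p.2⟩, rfl⟩
    · rw [Set.Finite.coe_toFinset, hLdef, Submodule.span_le]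
      rintro _ ⟨⟨g, j⟩, rfl⟩
      -- `g = gᵢ h` with `h ∈ H`
      set q : G ⧸ H := (g : G ⧸ H) with hq
      have hh : q.out⁻¹ * g ∈ H := by
        rw [← QuotientGroup.eq, QuotientGroup.out_eq']
      obtain ⟨hO1, -⟩ := mem_range_generalLinearGroup_map_iff.mp
        (show ρ (q.out⁻¹ * g) ∈ (Matrix.GeneralLinearGroup.map O.subtype).range from hh)
      have hcol : col ⟨g, j⟩ = ∑ k : Fin n,
          (⟨(ρ (q.out⁻¹ * g) : Matrix (Fin n) (Fin n) F) k j, hO1 k j⟩ : O) • col₀ ⟨q, k⟩ := by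
        have hg : g = q.out * (q.out⁻¹ * g) := by group
        ext i
        simp only [col, col₀, Finset.sum_apply, Pi.smul_apply]
        conv_lhs => rw [hg, map_mul, Units.val_mul, Matrix.mul_apply]
        refine Finset.sum_congr rfl fun k _ ↦ ?_
        rw [mul_comm]
        rfl
      rw [SetLike.mem_coe, hcol]
      exact Submodule.sum_mem _ fun k _ ↦ Submodule.smul_mem _ _
        (Submodule.subset_span ⟨⟨q, k⟩, rfl⟩)
  -- `L` is free of finite rank over the valuation ring `O`
  haveI : Module.Finite O L := Module.Finite.iff_fg.mpr hfg
  haveI : Module.Free O L := free_of_fg_submodule_valuationSubring L hfg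
  obtain ⟨m, b⟩ : Σ m : ℕ, Basis (Fin m) O L :=
    ⟨_, (Module.Free.chooseBasis O L).reindex (Fintype.equivFin _)⟩
  -- the basis vectors, in `Fⁿ`
  let b' : Fin m → (Fin n → F) := fun i ↦ (b i : Fin n → F)
  have hli : LinearIndependent F b' := by
    rw [← LinearIndependent.iff_fractionRing O F]
    exact b.linearIndependent.map' L.subtype (Submodule.ker_subtype L)
  have hLspan : (L : Set (Fin n → F)) ⊆ Submodule.span F (Set.range b') := by
    intro x hx
    have hx' : (⟨x, hx⟩ : L) ∈ Submodule.span O (Set.range b) := by rw [b.span_eq]; trivial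
    have himg := Submodule.mem_map_of_mem (f := L.subtype) hx'
    rw [Submodule.map_span, ← Set.range_comp] at himg
    exact Submodule.span_le_restrictScalars O F _ himg
  have hspan : ⊤ ≤ Submodule.span F (Set.range b') := by
    rw [← (Pi.basisFun F (Fin n)).span_eq, Submodule.span_le]
    rintro _ ⟨j, rfl⟩
    rw [SetLike.mem_coe, Pi.basisFun_apply]
    exact hLspan (hstd j)
  let B : Basis (Fin m) F (Fin n → F) := Basis.mk hli hspan
  obtain rfl : m = n := by
    simpa using (Module.finrank_eq_card_basis B).symm.trans (Module.finrank_fin_fun F)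
  -- the change-of-basis matrix `P` (columns `b i`)
  let Pm : Matrix (Fin m) (Fin m) F := (Pi.basisFun F (Fin m)).toMatrix B
  have hPm : ∀ i j, Pm i j = b' j i := fun i j ↦ by
    simp [Pm, Basis.toMatrix_apply, B]
  haveI : Invertible Pm := (Pi.basisFun F (Fin m)).invertibleToMatrix B
  let P : GL (Fin m) F := unitOfInvertible Pm
  refine ⟨P, fun g ↦ ?_⟩
  -- `ρ g` restricts to an `O`-linear automorphism of `L`
  let φ : G → (L →ₗ[O] L) := fun g ↦
    (((ρ g : Matrix (Fin m) (Fin m) F).mulVecLin).restrictScalars O).restrict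
      (p := L) (q := L) fun x hx ↦ hstab g x hx
  have hφ_mul : ∀ g g', φ (g * g') = φ g * φ g' := fun g g' ↦ by
    refine LinearMap.ext fun x ↦ Subtype.ext ?_
    change ((ρ (g * g') : GL (Fin m) F) : Matrix (Fin m) (Fin m) F) *ᵥ (x : Fin m → F) =
      (ρ g : Matrix (Fin m) (Fin m) F) *ᵥ ((ρ g' : Matrix (Fin m) (Fin m) F) *ᵥ (x : Fin m → F))
    rw [map_mul, Units.val_mul, Matrix.mulVec_mulVec]
  have hφ_one : φ 1 = 1 := by
    refine LinearMap.ext fun x ↦ Subtype.ext ?_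
    change ((ρ 1 : GL (Fin m) F) : Matrix (Fin m) (Fin m) F) *ᵥ (x : Fin m → F) = x
    rw [map_one, Units.val_one, Matrix.one_mulVec]
  let A : G → Matrix (Fin m) (Fin m) O := fun g ↦ LinearMap.toMatrix b b (φ g)
  have hA_mul : ∀ g g', A (g * g') = A g * A g' := fun g g' ↦ by
    simp only [A, hφ_mul]; exact LinearMap.toMatrix_mul b (φ g) (φ g')
  have hA_one : A 1 = 1 := by simp only [A, hφ_one]; exact LinearMap.toMatrix_one b
  let Ag : GL (Fin m) O :=
    ⟨A g, A g⁻¹, by rw [← hA_mul, mul_inv_cancel, hA_one], by rw [← hA_mul, inv_mul_cancel, hA_one]⟩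
  -- `ρ g * P = P * A g`
  have hkey : (ρ g : Matrix (Fin m) (Fin m) F) * Pm = Pm * (A g).map O.subtype := by
    ext i j
    have h1 : ((φ g (b j) : L) : Fin m → F) = ∑ k, (A g k j : F) • b' k := by
      have := (b.sum_repr (φ g (b j))).symm
      conv_lhs => rw [this]
      simp only [A, LinearMap.toMatrix_apply, Submodule.coe_sum, Submodule.coe_smul_of_tower, b']
      rfl
    have h2 : ((φ g (b j) : L) : Fin m → F) = (ρ g : Matrix (Fin m) (Fin m) F) *ᵥ b' j := rfl
    have h3 := congr_fun (h1.symm.trans h2) i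
    simp only [Finset.sum_apply, Pi.smul_apply, smul_eq_mul] at h3
    rw [Matrix.mul_apply, Matrix.mul_apply]
    simp only [hPm, Matrix.map_apply]
    rw [Matrix.mulVec, dotProduct] at h3
    rw [← h3]
    exact Finset.sum_congr rfl fun k _ ↦ mul_comm _ _
  refine ⟨Ag, Units.ext ?_⟩
  have hval : ((Matrix.GeneralLinearGroup.map O.subtype Ag : GL (Fin m) F) :
      Matrix (Fin m) (Fin m) F) = (A g).map O.subtype := rfl
  rw [hval, Units.val_mul, Units.val_mul]
  change (A g).map O.subtype = ⅟Pm * (ρ g : Matrix (Fin m) (Fin m) F) * Pm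
  rw [Matrix.mul_assoc, hkey, ← Matrix.mul_assoc, invOf_mul_self, Matrix.one_mul]


/-- **Integral models over any open valuation subring** (Serre, *Abelian ℓ-adic
representations*, I.1.1; Deligne–Serre 1974, 6.12; Darmon–Diamond–Taylor 1995, §2.1: "the image
of `ρ` is compact, and hence `ρ` can be conjugated to a homomorphism `G_ℚ → GL_d(𝒪)`").  For
`O ⊆ F` an open valuation subring, `G` compact and `ρ : G →ₜ* GL_n(F)` continuous, there are
`P ∈ GL_n(F)` and a homomorphism `ρ₀ : G → GL_n(O)` with `ρ₀(g) = P⁻¹ ρ(g) P` in `GL_n(F)` for all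
`g` (the accepted `exists_integralModel` without its principal-ideal-domain hypothesis).
[cite: SerreAbelianLadic1968, Ch. I §1.1, Remark 1] -/
theorem exists_integralModel_of_valuationSubring (hO : IsOpen (O : Set F))
    (ρ : G →ₜ* GL (Fin n) F) :
    ∃ (P : GL (Fin n) F) (ρ₀ : G →* GL (Fin n) O),
      ∀ g, Matrix.GeneralLinearGroup.map O.subtype (ρ₀ g) = P⁻¹ * ρ g * P := by
  obtain ⟨P, hP⟩ := exists_conj_mem_range_generalLinearGroup_map_of_valuationSubring hO ρ
  let φ : G →* GL (Fin n) F := (MulAut.conj P⁻¹).toMonoidHom.comp ρ.toMonoidHom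
  have hφ : ∀ g, φ g = P⁻¹ * ρ g * P := fun g ↦ by
    simp [φ]
  obtain ⟨ρ₀, hρ₀⟩ := exists_monoidHom_map_eq φ fun g ↦ (hφ g) ▸ hP g
  exact ⟨P, ρ₀, fun g ↦ (hρ₀ g).trans (hφ g)⟩

end Lattice

end Literature.NumberTheory.GaloisRepresentations
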